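import Mathlib

/-!
# T5HodgePairing — the Hodge-inner-product side of (N) (Tier 5, sub-step N1, support of p6)

route/T4-A3-p5.md Lemma A7.1: «(N) for σ ⟺ ∫_S ω_{ab} ∧ \overline{ω_{cd}} ≠ 0 ⟺ (ω_{ab}, ω_{cd})_{L²} ≠ 0,
where (α, β) := ∫_S α ∧ β̄ is the Hodge inner product on H^0(S, Ω²_S), which is positive definite. In
particular if ω_{cd} = λ·ω_{ab} with λ ≠ 0 then (N) for σ ⟺ ω_{ab} ≠ 0.» — and the multiplicity-one
reduction of N3 (m(σ) ≤ 1 ⟹ the two holomorphic 2-forms lie in one line of H^{2,0}(S)).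

Kernel-checked here, for an arbitrary complex inner product space `E` (= H^{2,0}(S) with the Hodge inner
product; the positivity is the INPUT, Lemma A7.1 / route/T5-N1-hodge-p6.md H1–H2):
* `inner_self_ne_zero_iff`: ⟪ω, ω⟫ ≠ 0 ↔ ω ≠ 0 («the diagonal case of (N) is automatic»);
* `inner_smul_ne_zero_iff`: ⟪ω, λ • ω⟫ ≠ 0 ↔ ω ≠ 0 ∧ λ ≠ 0 (the «in particular» of Lemma A7.1);
* `inner_ne_zero_iff_of_finrank_eq_one`: in a ONE-dimensional subspace `L` (multiplicity one),
  ⟪ω, ω'⟫ ≠ 0 ↔ ω ≠ 0 ∧ ω' ≠ 0 for ω, ω' ∈ L — the pairing statement (N) splits into two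
  non-vanishing statements, one per form (the shape of Proposition N*'s reduction);
* `norm_inner_le_norm`-form of Cauchy–Schwarz restated as `abs_pairing_le` for the record.
-/

namespace Summit.Ventures.HodgeRepro2.T5HodgePairing

open scoped InnerProductSpace

variable {E : Type*} [NormedAddCommGroup E] [InnerProductSpace ℂ E]

/-- Positive definiteness in the form used by Lemma A7.1: `⟪ω, ω⟫ ≠ 0 ↔ ω ≠ 0`. -/
theorem inner_self_ne_zero_iff (ω : E) : ⟪ω, ω⟫_ℂ ≠ 0 ↔ ω ≠ 0 :=
  inner_self_ne_zero

/-- The «in particular» of Lemma A7.1: if `ω' = λ • ω`, then `⟪ω, ω'⟫ ≠ 0 ↔ ω ≠ 0 ∧ λ ≠ 0`. -/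
theorem inner_smul_ne_zero_iff (ω : E) (c : ℂ) : ⟪ω, c • ω⟫_ℂ ≠ 0 ↔ ω ≠ 0 ∧ c ≠ 0 := by
  rw [inner_smul_right, mul_ne_zero_iff, inner_self_ne_zero, and_comm]

/-- Multiplicity one: if `ω, ω'` lie in a one-dimensional subspace `L` of `E`, the pairing `⟪ω, ω'⟫`
is non-zero exactly when both forms are non-zero. -/
theorem inner_ne_zero_iff_of_finrank_eq_one (L : Submodule ℂ E) (hL : Module.finrank ℂ L = 1)
    {ω ω' : E} (hω : ω ∈ L) (hω' : ω' ∈ L) : ⟪ω, ω'⟫_ℂ ≠ 0 ↔ ω ≠ 0 ∧ ω' ≠ 0 := by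
  obtain ⟨v, hv0, hv⟩ := finrank_eq_one_iff'.1 hL
  obtain ⟨a, ha⟩ := hv ⟨ω, hω⟩
  obtain ⟨b, hb⟩ := hv ⟨ω', hω'⟩
  have hv0' : (v : E) ≠ 0 := fun h => hv0 (Subtype.ext h)
  have hωa : ω = a • (v : E) := by
    have := congrArg Subtype.val ha
    simpa using this.symm
  have hωb : ω' = b • (v : E) := by
    have := congrArg Subtype.val hb
    simpa using this.symm
  rw [hωa, hωb, inner_smul_left, inner_smul_right, mul_ne_zero_iff, mul_ne_zero_iff,
    inner_self_ne_zero, smul_ne_zero_iff, smul_ne_zero_iff, map_ne_zero]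
  constructor
  · rintro ⟨ha, hb, hv⟩
    exact ⟨⟨ha, hv⟩, hb, hv⟩
  · rintro ⟨⟨ha, hv⟩, hb, -⟩
    exact ⟨ha, hb, hv⟩

/-- Cauchy–Schwarz for the record: `|⟪ω, ω'⟫| ≤ ‖ω‖ ‖ω'‖` (the period is bounded by the product of
the Hodge norms of the two forms). -/
theorem abs_pairing_le (ω ω' : E) : ‖⟪ω, ω'⟫_ℂ‖ ≤ ‖ω‖ * ‖ω'‖ :=
  norm_inner_le_norm ω ω'

end Summit.Ventures.HodgeRepro2.T5HodgePairing
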